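import Summits.ResolutionOfSingularities.ResolutionOfSingularities.Theorems.PurelyInseparableDim4ResConeCInfSecondTschirnhaus
import HarnessLib
import HarnessLib.Audit.Tags

/-!
# Purely inseparable four-folds — EXISTENCE OF THE SECOND TSCHIRNHAUS `ū = u − ψ(x_λ, x_μ)` FOR EVERY ROW: killing the
# `ū^{eu}`-row of the `x_f^{ef}`-layer of a C∞ residual, given the row's FLAG (cell `res-dim4-pi`, K2(p) lane, rung-1 POWER-CONE
# LINE «light pair of TAIL(p, p−1, 3) ∀ p», window half W8; the `p = 5` instance (`eu = 2`, `ef = 0`) is res-dim4-typ-1 g3's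
# `…ResConeCInfSecondTschirnhaus` p693881)

[OURS · counted 0 · cell `res-dim4-pi` · K2(p) lane (holder res-dim4-p-12 g5); the ENTRY of the light-pair power-cone line is
res-dim4-p-3 g5's port (bus 2026-08-29 10:45Z), which imports this file BY NAME; the row parameter is the line owner's GO (10:50Z) on
res-dim4-typ-1 g5's Q-FLAG (10:47Z).]  Nothing here proves K2(p) for any `p`, any TAIL(p, p−1, 3), any TAIL(7, d, e),
`NoIsolatedTrap p p` or resolution of singularities in dimension ≥ 4 / characteristic `p` — NOT proved.  AI kernel work, weaker than
expert review.  An EXISTENCE lemma for a coordinate change of OUR frame; it assumes the row's flag `≠ 0` and says nothing about the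
flagless branch of Q-FLAG (OPEN at `d ≥ 6`).

SETTING (fixed distinct letters `λ, μ, u, f`; `G` a polynomial — the residual of a C∞ state).  §1–§2 are the `x_f`-FREE row
(`ef = 0`) with a general `u`-exponent `eu`: INPUT the pair-ledger READ-OFF on the `x_f`-free rows below degree `M`
(`coeff_n G = 0` for `n_f = 0`, `|n| < M`, `n_λ = 0 ∨ n_μ = 0`), the FLAG `coeff_{x_λ x_μ u^{eu+1}} G ≠ 0`, the ENTRY
`coeff_{x_λ x_μ u^{eu}} G = 0`, and `((eu + 1 : ℕ) : K) ≠ 0`; OUTPUT (**`exists_second_tschirnhaus_prime`**): for every `N` a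
`ψ ∈ K[x_λ, x_μ]` (`ψ(0) = 0`) such that `τ = FrameChange.tsch u ψ` kills the `ū^{eu}`-row in jet form (`coeff_m (τ G) = 0` for
`m_u = eu`, `m_f = 0`, `|m| ≤ N + eu + 2`, `|m| < M`), keeps the flag and keeps the read-off — the `p = 5` proof VERBATIM
(`3 ↦ eu + 1`: below degree `M` the `x_f`-free part of `G` is `x_λ x_μ · S`, res-dim4-p-1 g3's `FrameChange.exists_jet` at the
letter `u` with `d := eu + 1` on `S`, and the `x_f`-free shadow `ψ := φ|_{x_f = 0}` — §1 `killVar_jet_pow` is the (5,4)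
`killVar_jet` with the exponent `2 ↦ k`).  §3 moves to the ROW `x_f^{ef}` (**`exists_second_tschirnhaus_row_prime`**): since
`τ` fixes `x_f` and `ψ` is `x_f`-free, `τ` acts row by row in `x_f` (`coeff_tsch_eq_coeff_tsch_divMonomial`), so the `ef = 0`
statement for `G.divMonomial (ef·e_f)` is the statement for the `x_f^{ef}`-row of `G`: INPUT the read-off / FLAG
`coeff_{x_λx_μu^{eu+1}f^{ef}} G ≠ 0` / ENTRY on that row, OUTPUT the dead row `(u, f)`-bidegree `(eu, ef)` in jet form, flag
and row read-off kept.  In the C∞ frame `eu + ef = d − 2` and the ENTRY is straightness (`x_λx_μu^{eu}f^{ef}` has degree `d` and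
is not `x_f^d`).
[cite: Abhyankar1990, Lecture 25 pp. 216–217 and Lecture 26 pp. 228–229] [cite: CossartPiltant2009, I.8.3.6]
bears_on: LADDER-RESOLUTION:D157-DOOR2 (res-dim4-pi · K2(p) · power cones · second Tschirnhaus ∀ row).  Supports
stmt-ResolutionOfSingularities-16155 (helper).
-/

set_option linter.dupNamespace false -- mandated namespace of this single-conjunct summit

noncomputable section

namespace Summit.ResolutionOfSingularities.ResolutionOfSingularities.Theorems.PIDim4

namespace ResCone

open MvPolynomial Finset FrameChange
open Literature.AlgebraicGeometry.Resolution

variable {K : Type} [Field K]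

/-! ## 1. The `x_f`-free shadow of a `u`-jet, any row exponent -/

/-- **The `x_f`-free shadow of a `u`-jet, row `u^k`**: if `φ` (`u ∉ vars φ`, `φ(0) = 0`) kills the rows `u^k·x^m`, `m_u = 0`,
`|m| ≤ N`, of `tsch u φ P`, then so does `ψ := φ|_{x_f = 0}` on the `x_f`-free ones, and `ψ ∈ K[x_{≠ u, f}]`, `ψ(0) = 0`
(the (5,4) `killVar_jet` is `k = 2`). [OURS] [folklore] -/
theorem killVar_jet_pow {u f : Fin 4} (huf : u ≠ f) {φ : MvPolynomial (Fin 4) K}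
    (hφs : ∀ a ∈ φ.support, a u = 0 ∧ 1 ≤ a.degree) (P : MvPolynomial (Fin 4) K) {N k : ℕ}
    (hφj : ∀ m : Fin 4 →₀ ℕ, m u = 0 → m.degree ≤ N → coeff (m + Finsupp.single u k) (tsch u φ P) = 0) :
    (∀ a ∈ (PointBlowup.killVar f φ).support, a u = 0 ∧ a f = 0 ∧ 1 ≤ a.degree) ∧
      constantCoeff (PointBlowup.killVar f φ) = 0 ∧ u ∉ (PointBlowup.killVar f φ).vars ∧
      f ∉ (PointBlowup.killVar f φ).vars ∧
      ∀ m : Fin 4 →₀ ℕ, m u = 0 → m f = 0 → m.degree ≤ N →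
        coeff (m + Finsupp.single u k) (tsch u (PointBlowup.killVar f φ) P) = 0 := by
  have hsupp : ∀ a ∈ (PointBlowup.killVar f φ).support, a u = 0 ∧ a f = 0 ∧ 1 ≤ a.degree := by
    intro a ha
    rw [mem_support_iff, coeff_killVar] at ha
    by_cases haf : a f = 0
    · rw [if_pos haf] at ha
      obtain ⟨hau, hdeg⟩ := hφs a (mem_support_iff.mpr ha)
      exact ⟨hau, haf, hdeg⟩
    · rw [if_neg haf] at ha
      exact absurd rfl ha
  refine ⟨hsupp, ?_, ?_, ?_, fun m hmu hmf hmN => ?_⟩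
  · by_contra hne
    have h0 := (hsupp 0 (mem_support_iff.mpr hne)).2.2
    rw [map_zero] at h0
    exact Nat.not_succ_le_zero 0 h0
  · exact (not_mem_vars_iff u _).mpr fun d hd => (hsupp d hd).1
  · exact (not_mem_vars_iff f _).mpr fun d hd => (hsupp d hd).2.1
  · rw [← coeff_tsch_eq_of_sub_mem_span_X (sub_killVar_mem_span_X f φ) P
      (by rw [Finsupp.add_apply, hmf, Finsupp.single_eq_of_ne huf.symm, add_zero])]
    exact hφj m hmu hmN

/-! ## 2. Existence of the second Tschirnhaus, `x_f`-free row `u^{eu}` -/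

/-- **EXISTENCE OF THE SECOND TSCHIRNHAUS `ū = u − ψ(x_λ, x_μ)`, row `u^{eu}` of the `x_f`-free layer.**  Fixed distinct letters
`λ, μ, u, f`; `G` with the `x_f`-free pair-ledger read-off below degree `M ≥ eu + 4`, flag `coeff_{x_λx_μu^{eu+1}} G ≠ 0`, entry
`coeff_{x_λx_μu^{eu}} G = 0`, and `eu + 1 ≠ 0` in `K`.  Then for every `N` there is `ψ` with `ψ(0) = 0`, `u, f ∉ vars ψ` such that
`τ := tsch u ψ` (i) kills the `ū^{eu}`-row in jet form: `coeff_m (τ G) = 0` for `m_u = eu`, `m_f = 0`, `|m| ≤ N + eu + 2`, `|m| < M`;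
(ii) keeps the flag; (iii) keeps the read-off below degree `M`. [OURS]
[cite: Abhyankar1990, Lecture 25 pp. 216–217 and Lecture 26 pp. 228–229] [cite: CossartPiltant2009, I.8.3.6] -/
theorem exists_second_tschirnhaus_prime {lam mu u f : Fin 4} (hlm : lam ≠ mu) (hul : u ≠ lam) (hum : u ≠ mu) (hfl : f ≠ lam)
    (hfm : f ≠ mu) (hfu : f ≠ u) {G : MvPolynomial (Fin 4) K} {M eu : ℕ} (heK : ((eu + 1 : ℕ) : K) ≠ 0) (hM : eu + 4 ≤ M)
    (hled : ∀ n : Fin 4 →₀ ℕ, n f = 0 → n.degree < M → (n lam = 0 ∨ n mu = 0) → coeff n G = 0)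
    (hV : coeff (Finsupp.single lam 1 + Finsupp.single mu 1 + Finsupp.single u (eu + 1)) G ≠ 0)
    (h2 : coeff (Finsupp.single lam 1 + Finsupp.single mu 1 + Finsupp.single u eu) G = 0) (N : ℕ) :
    ∃ ψ : MvPolynomial (Fin 4) K, constantCoeff ψ = 0 ∧ u ∉ ψ.vars ∧ f ∉ ψ.vars ∧
      (∀ a ∈ ψ.support, a u = 0 ∧ a f = 0 ∧ 1 ≤ a.degree) ∧
      (∀ m : Fin 4 →₀ ℕ, m u = eu → m f = 0 → m.degree ≤ N + eu + 2 → m.degree < M →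
        coeff m (tsch u ψ G) = 0) ∧
      coeff (Finsupp.single lam 1 + Finsupp.single mu 1 + Finsupp.single u (eu + 1)) (tsch u ψ G) =
        coeff (Finsupp.single lam 1 + Finsupp.single mu 1 + Finsupp.single u (eu + 1)) G ∧
      (∀ n : Fin 4 →₀ ℕ, n f = 0 → n.degree < M → (n lam = 0 ∨ n mu = 0) → coeff n (tsch u ψ G) = 0) := by
  set s : Fin 4 →₀ ℕ := Finsupp.single lam 1 + Finsupp.single mu 1 with hs
  set S := (PointBlowup.killVar f G).divMonomial s with hS
  -- the readings of `S`
  have hSf : ∀ m : Fin 4 →₀ ℕ, coeff m S = if m f = 0 then coeff (s + m) G else 0 := by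
    intro m
    rw [hS, coeff_divMonomial, coeff_killVar]
    have : (s + m : Fin 4 →₀ ℕ) f = m f := by
      rw [Finsupp.add_apply, hs, pair_apply_of_ne hfl hfm, zero_add]
    rw [this]
  have huf3 : (Finsupp.single u (eu + 1) : Fin 4 →₀ ℕ) f = 0 := by rw [Finsupp.single_apply, if_neg hfu.symm]
  have huf2' : (Finsupp.single u eu : Fin 4 →₀ ℕ) f = 0 := by rw [Finsupp.single_apply, if_neg hfu.symm]
  have huf2 : (Finsupp.single u (eu + 1 - 1) : Fin 4 →₀ ℕ) f = 0 := by rw [Finsupp.single_apply, if_neg hfu.symm]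
  have hc : coeff (Finsupp.single u (eu + 1)) S ≠ 0 := by
    rw [hSf, if_pos huf3]; exact hV
  have h0 : coeff (Finsupp.single u (eu + 1 - 1)) S = 0 := by
    rw [hSf, if_pos huf2, Nat.add_sub_cancel]; exact h2
  -- FILE D's jet solve at the letter `u`, `d = eu + 1`
  obtain ⟨φ, hφs, -, hφj⟩ := FrameChange.exists_jet u (d := eu + 1) (by omega) heK S hc h0 N
  have hφj' : ∀ m : Fin 4 →₀ ℕ, m u = 0 → m.degree ≤ N →
      coeff (m + Finsupp.single u eu) (tsch u φ S) = 0 := fun m hmu hmN => by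
    have h := hφj (tsch u φ) (tsch_X_self u φ) (fun i hi => tsch_X_of_ne φ hi) m hmu hmN
    rw [Nat.add_sub_cancel] at h
    exact h
  -- its `x_f`-free shadow `ψ`
  obtain ⟨hψs, hψ0, hψu, hψf, hψj⟩ := killVar_jet_pow hfu.symm hφs S hφj'
  set ψ := PointBlowup.killVar f φ with hψ
  have hτ0 : ∀ i, constantCoeff (tsch u ψ (X i)) = 0 := constantCoeff_tsch_X hψ0
  have hτl : tsch u ψ (X lam) = X lam := tsch_X_of_ne ψ hul.symm
  have hτm : tsch u ψ (X mu) = X mu := tsch_X_of_ne ψ hum.symm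
  have hτf : tsch u ψ (X f) = X f := tsch_X_of_ne ψ hfu
  have hread := fun (m : Fin 4 →₀ ℕ) (hmf : m f = 0) (hmM : m.degree < M) =>
    coeff_map_eq_of_lowRows (tsch u ψ) hlm hτl hτm hτf hτ0 hled hmf hmM
  refine ⟨ψ, hψ0, hψu, hψf, hψs, fun m hmu hmf hmN hmM => ?_, ?_, fun n hnf hnM hn => ?_⟩
  · -- (i) the `ū^{eu}`-row
    rw [hread m hmf hmM]
    split_ifs with hle
    · -- `m = m₀ + s + eu·u` with `m₀ ∈ ⟨λ, μ⟩`-exponents of degree `≤ N`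
      have hsu : s u = 0 := by rw [hs, pair_apply_of_ne hul hum]
      have hsf : s f = 0 := by rw [hs, pair_apply_of_ne hfl hfm]
      have hle2 : s + Finsupp.single u eu ≤ m := by
        intro i
        rw [Finsupp.add_apply, Finsupp.single_apply]
        by_cases hiu : u = i
        · rw [if_pos hiu, ← hiu, hsu, zero_add, hmu]
        · rw [if_neg hiu, add_zero]; exact hle i
      set m₀ := m - (s + Finsupp.single u eu) with hm₀
      have hm : m = m₀ + (s + Finsupp.single u eu) := (tsub_add_cancel_of_le hle2).symm
      have hsub : m - s = m₀ + Finsupp.single u eu := by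
        rw [hm, add_comm s, ← add_assoc, add_tsub_cancel_right]
      have hm₀u : m₀ u = 0 := by
        have := congrArg (fun g : Fin 4 →₀ ℕ => g u) hm
        simp only [Finsupp.add_apply, hmu, hsu, Finsupp.single_eq_same] at this
        omega
      have hm₀f : m₀ f = 0 := by
        have := congrArg (fun g : Fin 4 →₀ ℕ => g f) hm
        simp only [Finsupp.add_apply, hmf, hsf, huf2'] at this
        omega
      have hm₀N : m₀.degree ≤ N := by
        have := congrArg Finsupp.degree hm
        simp only [map_add, hs, Finsupp.degree_single] at this
        omega
      rw [hsub]
      exact hψj m₀ hm₀u hm₀f hm₀N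
    · rfl
  · -- (ii) the flag is kept
    have hf5 : (s + Finsupp.single u (eu + 1) : Fin 4 →₀ ℕ) f = 0 := by
      rw [Finsupp.add_apply, hs, pair_apply_of_ne hfl hfm, huf3]
    have hdeg : (s + Finsupp.single u (eu + 1)).degree < M := by
      rw [map_add, hs, map_add, Finsupp.degree_single, Finsupp.degree_single, Finsupp.degree_single]; omega
    rw [show Finsupp.single lam 1 + Finsupp.single mu 1 + Finsupp.single u (eu + 1) = s + Finsupp.single u (eu + 1) by rw [hs],
      hread _ hf5 hdeg, if_pos le_self_add, add_tsub_cancel_left,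
      FrameChange.coeff_single_frameChange (tsch u ψ) u ψ (tsch_X_self u ψ) (fun i hi => tsch_X_of_ne ψ hi)
        (fun a ha => ⟨(hψs a ha).1, (hψs a ha).2.2⟩) S (eu + 1), hSf, if_pos huf3]
  · -- (iii) the read-off is kept
    rw [hread n hnf hnM, if_neg]
    rw [pair_le_iff hlm]
    omega

/-! ## 3. The row `x_f^{ef}`: the move acts row by row in `x_f` -/

/-- **A move at `u` with `x_f`-free parameter keeps every monomial inside its `x_f`-row**: `coeff_n (tsch u ψ (c·x^d)) = 0` unless
`n_f = d_f`. [folklore] -/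
theorem coeff_tsch_monomial_of_apply_ne {u f : Fin 4} (huf : u ≠ f) {ψ : MvPolynomial (Fin 4) K} (hψf : f ∉ ψ.vars)
    {d n : Fin 4 →₀ ℕ} (hne : n f ≠ d f) (c : K) : coeff n (tsch u ψ (monomial d c)) = 0 := by
  classical
  -- `τ (x_i)` is `x_f`-free for `i ≠ f`
  have hfree : ∀ i, i ≠ f → f ∉ (tsch u ψ (X i)).vars := by
    intro i hif
    by_cases hiu : i = u
    · subst hiu
      rw [tsch_X_self]
      intro hmem
      have := vars_add_subset _ _ hmem
      rw [Finset.mem_union, vars_X, Finset.mem_singleton] at this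
      rcases this with h | h
      · exact hif h.symm
      · exact hψf h
    · rw [tsch_X_of_ne ψ hiu, vars_X, Finset.mem_singleton]
      exact fun h => hif h.symm
  -- `τ (c·x^d) = c · x_f^{d_f} · W`, `W` free of `x_f`
  set W : MvPolynomial (Fin 4) K := ∏ i ∈ d.support.erase f, (tsch u ψ (X i)) ^ d i with hW
  have hWf : f ∉ W.vars := by
    intro hmem
    obtain ⟨i, hi, hmi⟩ := Finset.mem_biUnion.mp (vars_prod _ hmem)
    exact hfree i (Finset.ne_of_mem_erase hi) (vars_pow _ _ hmi)
  have hτ : tsch u ψ (monomial d c) = C c * (X f ^ d f * W) := by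
    rw [monomial_eq, map_mul, ← algebraMap_eq, AlgHom.commutes, algebraMap_eq, Finsupp.prod, map_prod]
    congr 1
    simp_rw [map_pow]
    by_cases hfd : f ∈ d.support
    · rw [← Finset.mul_prod_erase _ _ hfd, tsch_X_of_ne ψ huf.symm]
    · rw [Finsupp.notMem_support_iff.mp hfd, pow_zero, one_mul, hW, Finset.erase_eq_of_notMem hfd]
  rw [hτ, coeff_C_mul, X_pow_eq_monomial, coeff_monomial_mul']
  split_ifs with hle
  · rw [one_mul]
    suffices h : coeff (n - Finsupp.single f (d f)) W = 0 by rw [h, mul_zero]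
    by_contra h
    refine hWf ((mem_vars_iff_mem_support f).mpr ⟨n - Finsupp.single f (d f), mem_support_iff.mpr h, ?_⟩)
    rw [Finsupp.mem_support_iff, Finsupp.tsub_apply, Finsupp.single_eq_same]
    have := hle f
    rw [Finsupp.single_eq_same] at this
    omega
  · rw [mul_zero]

/-- **The move commutes with reading an `x_f`-row**: for `n_f = ef`, `coeff_n (tsch u ψ G) = coeff_{n − ef·e_f} (tsch u ψ (G / x_f^{ef}))`
(`G = x_f^{ef}·(G / x_f^{ef}) + R`, `τ` fixes `x_f^{ef}`, and `τ R` stays in the rows `x_f^{< ef}`). [folklore] -/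
theorem coeff_tsch_eq_coeff_tsch_divMonomial {u f : Fin 4} (huf : u ≠ f) {ψ : MvPolynomial (Fin 4) K} (hψf : f ∉ ψ.vars)
    (ef : ℕ) (G : MvPolynomial (Fin 4) K) {n : Fin 4 →₀ ℕ} (hnf : n f = ef) :
    coeff n (tsch u ψ G) = coeff (n - Finsupp.single f ef) (tsch u ψ (G.divMonomial (Finsupp.single f ef))) := by
  classical
  have hsplit := G.divMonomial_add_modMonomial (Finsupp.single f ef)
  have hXf : tsch u ψ (monomial (Finsupp.single f ef) (1 : K)) = monomial (Finsupp.single f ef) 1 := by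
    rw [← X_pow_eq_monomial, map_pow, tsch_X_of_ne ψ huf.symm]
  have hle : Finsupp.single f ef ≤ n := by
    intro i
    by_cases hi : i = f
    · subst hi; rw [Finsupp.single_eq_same, hnf]
    · rw [show (Finsupp.single f ef : Fin 4 →₀ ℕ) i = 0 from Finsupp.single_eq_of_ne hi]
      exact Nat.zero_le _
  -- the remainder contributes nothing to the row `x_f^{ef}`
  have hR : coeff n (tsch u ψ (G.modMonomial (Finsupp.single f ef))) = 0 := by
    set R := G.modMonomial (Finsupp.single f ef) with hRdef
    conv_lhs => rw [R.as_sum, map_sum, coeff_sum]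
    refine Finset.sum_eq_zero fun d hd => coeff_tsch_monomial_of_apply_ne huf hψf (fun heq => ?_) _
    -- `d` is a monomial of the remainder: `d f < ef = n f`
    have hdle : Finsupp.single f ef ≤ d := by
      intro i
      by_cases hi : i = f
      · subst hi; rw [Finsupp.single_eq_same, ← heq, hnf]
      · rw [show (Finsupp.single f ef : Fin 4 →₀ ℕ) i = 0 from Finsupp.single_eq_of_ne hi]
        exact Nat.zero_le _
    exact (mem_support_iff.mp hd) (coeff_modMonomial_of_le _ hdle)
  conv_lhs => rw [← hsplit, map_add, map_mul, hXf, coeff_add, coeff_monomial_mul', if_pos hle, one_mul, hR, add_zero]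

/-- **EXISTENCE OF THE SECOND TSCHIRNHAUS FOR THE ROW `(eu, ef)`** (§2 applied to `G.divMonomial (ef·e_f)`).  INPUT: the pair-ledger
read-off on the `x_f^{ef}`-row below degree `M + ef` (`coeff_n G = 0` for `n_f = ef`, `|n| < M + ef`, `n_λ = 0 ∨ n_μ = 0`), the FLAG
`coeff_{x_λx_μu^{eu+1}f^{ef}} G ≠ 0`, the ENTRY `coeff_{x_λx_μu^{eu}f^{ef}} G = 0`, `eu + 1 ≠ 0` in `K`, `M ≥ eu + 4`.  OUTPUT: for
every `N` a `ψ ∈ K[x_λ, x_μ]` (`ψ(0) = 0`) such that `τ := tsch u ψ` (i) kills the row: `coeff_m (τ G) = 0` for `m_u = eu`, `m_f = ef`,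
`|m| ≤ N + eu + 2 + ef`, `|m| < M + ef`; (ii) keeps the flag; (iii) keeps the row's read-off. [OURS]
[cite: Abhyankar1990, Lecture 25 pp. 216–217 and Lecture 26 pp. 228–229] [cite: CossartPiltant2009, I.8.3.6] -/
theorem exists_second_tschirnhaus_row_prime {lam mu u f : Fin 4} (hlm : lam ≠ mu) (hul : u ≠ lam) (hum : u ≠ mu)
    (hfl : f ≠ lam) (hfm : f ≠ mu) (hfu : f ≠ u) {G : MvPolynomial (Fin 4) K} {M eu ef : ℕ} (heK : ((eu + 1 : ℕ) : K) ≠ 0)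
    (hM : eu + 4 ≤ M)
    (hled : ∀ n : Fin 4 →₀ ℕ, n f = ef → n.degree < M + ef → (n lam = 0 ∨ n mu = 0) → coeff n G = 0)
    (hV : coeff (Finsupp.single lam 1 + Finsupp.single mu 1 + Finsupp.single u (eu + 1) + Finsupp.single f ef) G ≠ 0)
    (h2 : coeff (Finsupp.single lam 1 + Finsupp.single mu 1 + Finsupp.single u eu + Finsupp.single f ef) G = 0) (N : ℕ) :
    ∃ ψ : MvPolynomial (Fin 4) K, constantCoeff ψ = 0 ∧ u ∉ ψ.vars ∧ f ∉ ψ.vars ∧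
      (∀ a ∈ ψ.support, a u = 0 ∧ a f = 0 ∧ 1 ≤ a.degree) ∧
      (∀ m : Fin 4 →₀ ℕ, m u = eu → m f = ef → m.degree ≤ N + eu + 2 + ef → m.degree < M + ef →
        coeff m (tsch u ψ G) = 0) ∧
      coeff (Finsupp.single lam 1 + Finsupp.single mu 1 + Finsupp.single u (eu + 1) + Finsupp.single f ef) (tsch u ψ G) =
        coeff (Finsupp.single lam 1 + Finsupp.single mu 1 + Finsupp.single u (eu + 1) + Finsupp.single f ef) G ∧
      (∀ n : Fin 4 →₀ ℕ, n f = ef → n.degree < M + ef → (n lam = 0 ∨ n mu = 0) → coeff n (tsch u ψ G) = 0) := by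
  classical
  set G' := G.divMonomial (Finsupp.single f ef) with hG'
  -- exponents of `x_f`-degree `ef` are `e_f^{ef} + (x_f-free)`
  have hdec : ∀ n : Fin 4 →₀ ℕ, n f = ef → n = Finsupp.single f ef + (n - Finsupp.single f ef) ∧
      (n - Finsupp.single f ef) f = 0 ∧ (n - Finsupp.single f ef).degree + ef = n.degree ∧
      (n - Finsupp.single f ef) lam = n lam ∧ (n - Finsupp.single f ef) mu = n mu ∧ (n - Finsupp.single f ef) u = n u := by
    intro n hnf
    have hle : Finsupp.single f ef ≤ n := by
      intro i
      by_cases hi : i = f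
      · subst hi; rw [Finsupp.single_eq_same, hnf]
      · rw [show (Finsupp.single f ef : Fin 4 →₀ ℕ) i = 0 from Finsupp.single_eq_of_ne hi]
        exact Nat.zero_le _
    have heq : n = Finsupp.single f ef + (n - Finsupp.single f ef) := (add_tsub_cancel_of_le hle).symm
    refine ⟨heq, ?_, ?_, ?_, ?_, ?_⟩
    · rw [Finsupp.tsub_apply, Finsupp.single_eq_same, hnf, Nat.sub_self]
    · have := congrArg Finsupp.degree heq
      rw [map_add, Finsupp.degree_single] at this
      omega
    · rw [Finsupp.tsub_apply, Finsupp.single_eq_of_ne hfl.symm, Nat.sub_zero]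
    · rw [Finsupp.tsub_apply, Finsupp.single_eq_of_ne hfm.symm, Nat.sub_zero]
    · rw [Finsupp.tsub_apply, Finsupp.single_eq_of_ne hfu.symm, Nat.sub_zero]
  -- the hypotheses of §2 for `G'`
  have hled' : ∀ n : Fin 4 →₀ ℕ, n f = 0 → n.degree < M → (n lam = 0 ∨ n mu = 0) → coeff n G' = 0 := by
    intro n hnf hnM hn
    rw [hG', coeff_divMonomial]
    refine hled _ ?_ ?_ ?_
    · rw [Finsupp.add_apply, Finsupp.single_eq_same, hnf, add_zero]
    · rw [map_add, Finsupp.degree_single]; omega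
    · rwa [Finsupp.add_apply, Finsupp.add_apply, Finsupp.single_eq_of_ne hfl.symm, Finsupp.single_eq_of_ne hfm.symm, zero_add,
        zero_add]
  have hkey : ∀ k : ℕ, Finsupp.single f ef + (Finsupp.single lam 1 + Finsupp.single mu 1 + Finsupp.single u k) =
      Finsupp.single lam 1 + Finsupp.single mu 1 + Finsupp.single u k + Finsupp.single f ef := fun k => by
    rw [add_comm]
  have hV' : coeff (Finsupp.single lam 1 + Finsupp.single mu 1 + Finsupp.single u (eu + 1)) G' ≠ 0 := by
    rw [hG', coeff_divMonomial, hkey]; exact hV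
  have h2' : coeff (Finsupp.single lam 1 + Finsupp.single mu 1 + Finsupp.single u eu) G' = 0 := by
    rw [hG', coeff_divMonomial, hkey]; exact h2
  obtain ⟨ψ, hψ0, hψu, hψf, hψs, hrow, hflag, hoff⟩ :=
    exists_second_tschirnhaus_prime hlm hul hum hfl hfm hfu heK hM hled' hV' h2' N
  -- transport back through `coeff_m (τ G) = coeff_{m − ef·e_f} (τ G')`
  have hback : ∀ n : Fin 4 →₀ ℕ, n f = ef → coeff n (tsch u ψ G) = coeff (n - Finsupp.single f ef) (tsch u ψ G') :=
    fun n hnf => coeff_tsch_eq_coeff_tsch_divMonomial hfu.symm hψf ef G hnf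
  refine ⟨ψ, hψ0, hψu, hψf, hψs, fun m hmu hmf hmN hmM => ?_, ?_, fun n hnf hnM hn => ?_⟩
  · obtain ⟨-, h0f, hdeg, -, -, h0u⟩ := hdec m hmf
    rw [hback m hmf]
    exact hrow _ (by rw [h0u, hmu]) h0f (by omega) (by omega)
  · have hf : (Finsupp.single lam 1 + Finsupp.single mu 1 + Finsupp.single u (eu + 1) + Finsupp.single f ef : Fin 4 →₀ ℕ) f = ef := by
      rw [Finsupp.add_apply, Finsupp.add_apply, Finsupp.add_apply, Finsupp.single_eq_of_ne hfl, Finsupp.single_eq_of_ne hfm,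
        Finsupp.single_eq_of_ne hfu, Finsupp.single_eq_same, zero_add, zero_add, zero_add]
    rw [hback _ hf, add_tsub_cancel_right, hflag, hG', coeff_divMonomial, hkey]
  · obtain ⟨-, h0f, hdeg, h0l, h0m, -⟩ := hdec n hnf
    rw [hback n hnf]
    exact hoff _ h0f (by omega) (by rw [h0l, h0m]; exact hn)

end ResCone

end Summit.ResolutionOfSingularities.ResolutionOfSingularities.Theorems.PIDim4

end
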